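import Literature.MathematicalPhysics.QuantumFieldTheory.Balaban1983to89.B9SectBGReadY
import Literature.MathematicalPhysics.QuantumFieldTheory.Balaban1983to89.B9Ineq386RightEntry
import Literature.MathematicalPhysics.QuantumFieldTheory.Balaban1983to89.Node00.OpsYDeltaA

/-!
# Balaban [B9], Thm 3.4 p. 400 with Thm 3.3 p. 399 and (3.84)–(3.86) p. 407 — THE (3.42) MEMBER OF THE SECT.-B STEP OF RECORD FOR THE
# BOND SECTOR `KACU` (print's reading R13-U1), ROUTE F: r06's LETTER-FREE (3.84)–(3.86) engines run on NODE 00's own bond carrier, with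
# print's (3.85) DISPLAYED — `DaF` ∕ `GbF` ∕ `VF`, `GbF_eq_of_two_sided`, ★ `Step385F`, ★★ `eBlock_KACU_prod_of_385`, ★★★ `stepEPos_KACU_of_385`

T. Bałaban, *Propagators for lattice gauge theories in a background field*, Commun. Math. Phys. **99** (1985) 389–434
[`Balaban1985BackgroundPropagators`, "B9"]; [4] = T. Bałaban, *Propagators and renormalization transformations for lattice gauge
theories. II*, Commun. Math. Phys. **96** (1984) 223–250 [`Balaban1984PropagatorsII`].

statement-level skeleton of published theorems with citation tags; proofs where landed; nothing here is a claim about the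
Yang–Mills mass gap

THE PRINTED LOCUS (p. 407, verbatim): *«We can write (3.82) as Δ_a(U′U) = Δ_a(U) − V(A) = (I − V(A)G(U))Δ_a(U). (3.84) Using the bounds
(3.73), (3.77), (3.83) and assuming that Theorem 3.3 holds for G(U), we get |(V(A)G(U)J)(b)| ≦ O(1)α₁e^{−(1/2)δ₀d(y,y′)}|J| for b ∈ Δ(y),
supp J ⊂ Δ(y′). (3.85) … hence V(A)G(U) is a small operator in supremum norm, and we have G(U′U) = G(U)(I − V(A)G(U))⁻¹ = Σ_{n=0}^∞
G(U)(V(A)G(U))ⁿ, (3.86) and convergence is in the operator norm for α₁ sufficiently mall [sic]. … This way we get all these inequalities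
for the operator G(U′U).»*; Thm 3.3 p. 399 («the operator G(U) (a = 1) satisfies the inequalities (3.42)–(3.47)»); (3.27) p. 395
(«G(U) = Δ_a(U)⁻¹»); (3.42) p. 397.

WHY THIS FILE (pub-ymgap N06 row 13, G side; seat dag-n06-c gen 13).  The target of record `B9SectBCodedReadingsU.SectBStepU` asks, for the
bond-sector family `KACU` (NODE 00's U-letter reading `kernelFamilyBU` of the letter `OA := G(·) = Node00.GAY parS parB GpS` over the coded
carrier), the positive-input block-step `StepEPos … (KACU∘f)`: the (3.42) block of `G(U′U)` for `U′` in the class (3.37) at `α₁ ≦ a₁`, from Theorems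
3.1–3.3 at `U`.  The letters route (frames `B9SectBGFrameV3` + an instance identifying NODE 00's `Δ_a(V)` with r06's concrete word — DESIGN
POINT 2 of the seat's G-SIDE-PLAN; LOCATED-12: the frames' law `coord_mul` is moreover not inhabitable at the coded root) is not available.  THIS FILE
takes print's own three-line route (3.84) ⇒ (3.86) in r06's LETTER-FREE operator form (`B9Ineq385VG.exists_gExt_of_385`, `gExt_leftEntry_of_386`,
`B9Ineq386RightEntry.gExt_rightEntry_of_386L`), run DIRECTLY on NODE 00's bond carrier `FBondY × ι` (block map `ι_B ∘ blkV1`) where gen 12's (3.42)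
READ ∕ WRITE dictionary `B9SectBGReadY.readG342Y_KACU` ∕ `writeG342Y_KACU` lives — so NO identification of `Δ_a` between models is needed: `Δ_a(U)`,
`G(U)`, `V(A) := Δ_a(U) − Δ_a(U′U)` are NODE 00's own operators in real coordinates (§1), and the inverse `G(U′U)` the Neumann series produces IS
NODE 00's `GAY (U′U)` by uniqueness of two-sided inverses (`GbF_eq_of_two_sided`).
* §1 `DaF V := conj b (Δ_a(V)|ℝ)`, `GbF V := conj b (G(V)|ℝ)`, `VF U a := DaF U − DaF (e^{iηa}U)`; `DaF_mul_GbF` ∕ `GbF_mul_DaF` (under `IsUnit Δ_a(V)`),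
  `DaF_sub_VF`, ★ `GbF_eq_of_two_sided` (a two-sided inverse of `DaF W` forces `Δ_a(W)` bijective, hence a unit, and is `GbF W`).
* §2 the block map `blkF`, the output predicate `Maj385F` and ★ **`Step385F` — print's (3.85) `V(A)G(U) ≺ κ·α₁·e^{−ρd}` AND ITS LEFT TWIN
  `G(U)V(A) ≺ κ·α₁·e^{−ρd}` at NODE 00's letters, DISPLAYED in the positive-input step shape `B9SectBStepWhole.StepPos … (ℝ × ℝ)`** (output
  `(κ, ρ)` uniform in the member; inputs = Theorems 3.1–3.3 at `U`, exactly print's «assuming that Theorem 3.3 holds for G(U)» plus the (3.77)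
  dependence on Theorems 3.1–3.2).  The twin is NOT printed: r06 derives it (`B9Ineq386CommSum.hasMajorant_GV_of_gradForm_comm_sum`) because the
  operator-form right entry (3.42)₃ needs it; here both are HYPOTHESES.
* §3 ★★ `eBlock_KACU_prod_of_385` — ONE configuration, explicit constants: `EBlock KACU B₀ δ₀ (base U)`, the two majorants at `(U, a)`, [4] (2.61)
  and the scale transfer of `Lʲη` at `ρ₀ := min ρ δ₀`, exponent `α′ ∈ [0, 1/3]`, and `κα₁c₁(α′) ≦ 1/2` give `EBlock KACU (M₂Σ‖b‖·2(M₂Σ‖b‖B₀)Λ²(c₁+1))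
  ((1−3α′)ρ₀) (prod U a)` and `IsUnit Δ_a(e^{iηa}U)` (the analytic-extension clause for G: `GAY_inv_prod_of_385`).
* §4 ★★★ `stepEPos_KACU_of_385 : … → StepEPos dB c35 (geo9Y∘f) (codingYx …).bg (KSCU∘f) (KACU∘f) (pullS Cinv) (KACU∘f)` from the structural
  binders `hι` (section of `β`), `hM₂`∕`hrepr`∕`hcR` (real coordinates of `𝔸`), the DISPLAYED `hunitA : GVal U → IsUnit (Δ_a(U))` (Thm 3.3 ∕ 3.11's
  regime) and `h385 : Step385F …`; thresholds from n06-k's (2.61) supplier (`B9SectBGpFrameCodedY.exists_d261`) and window scale transfers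
  (`B9RWSums347DefiniteFacesWindow.scaleTransfer6_window_geo9Y`) at `α′ = 1/100`.

HONEST SCOPE.  (3.85) and its left twin are HYPOTHESES (named, printed locus p. 407), not proved here; so is the invertibility of `Δ_a(U)` at
`G`-valued `U`.  Everything else is NODE 00's definitions + r06's kernel-checked engines + gen 12's dictionary.  The Hölder ∕ `L²` ∕ (3.47) members of
`KACU` are NOT here.  Count-neutral; N06 NOT discharged; no summit ∕ sub-problem statement is proved; one finite lattice programme — nothing
continuum ∕ OS ∕ mass-gap ∕ Clay.  No `sorry`, no `axiom`, no `instance`, no `notation`.  Seat dag-n06-c g13, 2026-08-28; `--supports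
stmt-QuantumFields-27364`.

RELATED IN THE TREE, NOT DUPLICATED: r06 `B9Ineq385VG` ((3.83)∕(3.85)∕(3.86) DERIVED in r06's letters; §6 `exists_gExt_of_385`, §5 `gExt_leftEntry_of_386`
USED BY NAME), `B9Ineq386RightEntry` (`gExt_rightEntry_of_386L` USED BY NAME), `B9Thm34GEntries342` ∕ `B9Thm34GUniformBlk` (the same for r06's CONCRETE
`Δ_a` word — the letters route), gen 12 `B9SectBGReadY` (READ ∕ WRITE), `B9SectBGFrameV3` (the frames of the letters route), NODE 00 `Node00.OpsYDeltaA`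
(`deltaAY`, `GAY`, `deltaAY_mul_GAY`), gen 7 `B9SectBGpLettersY.gopC_eq` (the `G′` twin of `GbF_eq_of_two_sided`, with print's units).
-/

noncomputable section

namespace Literature.MathematicalPhysics.QuantumFieldTheory.Balaban1983to89.B9SectBGStepCodedF

open Literature.MathematicalPhysics.QuantumFieldTheory.Balaban1983to89
open Literature.MathematicalPhysics.QuantumFieldTheory.Balaban1983to89.B6RandomWalk (HasMajorant hasMajorant_mono Triangle254 Ineq261)
open Literature.MathematicalPhysics.QuantumFieldTheory.Balaban1983to89.B9Thm34Ext (toB6)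
open Literature.MathematicalPhysics.QuantumFieldTheory.Balaban1983to89.B9Ineq347 (ScaleTransfer)
open Literature.MathematicalPhysics.QuantumFieldTheory.Balaban1983to89.B9Ineq385VG (exists_gExt_of_385 gExt_leftEntry_of_386)
open Literature.MathematicalPhysics.QuantumFieldTheory.Balaban1983to89.B9Ineq386RightEntry (gExt_rightEntry_of_386L)
open Literature.MathematicalPhysics.QuantumFieldTheory.Balaban1983to89.B9FromB6 (EBlock)
open Literature.MathematicalPhysics.QuantumFieldTheory.Balaban1983to89.B9Eq39Adjoint (fluct)
open Literature.MathematicalPhysics.QuantumFieldTheory.Balaban1983to89.B9Eq352DivFormLetters (conj coordEquiv)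
open Literature.MathematicalPhysics.QuantumFieldTheory.Balaban1983to89.B6GlobalChartV1 (blkV1)
open Literature.MathematicalPhysics.QuantumFieldTheory.Balaban1983to89.B6KLevelCensusIndexV1 (KIdx kGeo)
open Literature.MathematicalPhysics.QuantumFieldTheory.Balaban1983to89.B6Ineq2142KLevelV1 (β)
open Literature.MathematicalPhysics.QuantumFieldTheory.Balaban1983to89.B9GeoNormsKLevelV1 (geo9K)
open Literature.MathematicalPhysics.QuantumFieldTheory.Balaban1983to89.B9CoReadingCoords (cdBₗ cdsBₗ lapBₗ lapBₗ_apply)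
open Literature.MathematicalPhysics.QuantumFieldTheory.Balaban1983to89.B9SectBCodedCarrier (CCfg Coding pullS)
open Literature.MathematicalPhysics.QuantumFieldTheory.Balaban1983to89.B9Eq360DeltaPrimeAY (AfldY mulY)
open Literature.MathematicalPhysics.QuantumFieldTheory.Balaban1983to89.B9PinMembersKLevelV1 (MemberY geo9Y bg9Y)
open Literature.MathematicalPhysics.QuantumFieldTheory.Balaban1983to89.B9SectBGpLettersY (GVal decY)
open Literature.MathematicalPhysics.QuantumFieldTheory.Balaban1983to89.B9SectBGpLettersY (conj_one)
open Literature.MathematicalPhysics.QuantumFieldTheory.Balaban1983to89.B9SectBGpFrameCodedY (codingYx exists_d261)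
open Literature.MathematicalPhysics.QuantumFieldTheory.Balaban1983to89.B9SectBCodedReadingsU (KSCU KACU)
open Literature.MathematicalPhysics.QuantumFieldTheory.Balaban1983to89.B9SectBGReadY (readG342Y_KACU writeG342Y_KACU)
open Literature.MathematicalPhysics.QuantumFieldTheory.Balaban1983to89.B9SectBStepWhole (StepPos StepEPos)
open Literature.MathematicalPhysics.QuantumFieldTheory.Balaban1983to89.B9GeoLemma21KLevelV1 (geo9Y_dist_triangle geo9Y_dist_self geo9Y_dist_comm
  geo9Y_len_pos geo9K_len_pos)
open Literature.MathematicalPhysics.QuantumFieldTheory.Balaban1983to89.B9RWSums347DefiniteFacesWindow (geo9Y_dist_nonneg scaleTransfer6_window_geo9Y)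
open Literature.MathematicalPhysics.QuantumFieldTheory.Balaban1983to89.Node00 (SiteY BlkY FBondY IBondY CfgY SiteParY BondParY SiteOpY BondOpY deltaAY GAY
  deltaAY_mul_GAY GAY_mul_deltaAY)

variable {d ℓ : ℕ} {hd : 1 ≤ d + 1} {hL : Odd (ℓ + 1) ∧ 1 < ℓ + 1} {b₀ b₁ : ℝ} {Mstar : ℕ}
variable {𝔸 : Type} [NormedRing 𝔸] [NormedAlgebra ℂ 𝔸] [CompleteSpace 𝔸]
variable {ι : Type} [Fintype ι]

/-! ## §1 NODE 00's `Δ_a(V)`, `G(V)` and the variation `V(A) = Δ_a(U) − Δ_a(U′U)` in real coordinates on the bond carrier -/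

section Letters

variable (i : KIdx d ℓ hd hL b₀ b₁) (parS : SiteParY 𝔸 i) (parB : BondParY 𝔸 i) (GpS : SiteOpY 𝔸 i) (b : Module.Basis ι ℝ 𝔸)

/-- `Δ_a(V)` of (3.26) — NODE 00's `deltaAY` — as an `ℝ`-linear operator of the real bond carrier `FBondY × ι → ℝ` (conjugation by the coordinates of
the basis `b`). [cite: Balaban1985BackgroundPropagators, (3.26) p.395; Balaban1984PropagatorsII, (2.51) p.232] -/
def DaF (V : CfgY 𝔸 i) : Module.End ℝ (FBondY i × ι → ℝ) := conj b ((deltaAY i parS parB GpS V).restrictScalars ℝ)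

/-- `G(V) = Δ_a(V)⁻¹` of (3.27) — NODE 00's `GAY` (the `Ring.inverse`) — in real coordinates. [cite: Balaban1985BackgroundPropagators, (3.27) p.395; Balaban1984PropagatorsII, (2.51) p.232] -/
def GbF (V : CfgY 𝔸 i) : Module.End ℝ (FBondY i × ι → ℝ) := conj b ((GAY i parS parB GpS V).restrictScalars ℝ)

/-- **`V(A) := Δ_a(U) − Δ_a(U′U)`**, `U′ = e^{iηa}` — the total variation of (3.82)∕(3.84) («Δ_a(U′U) = Δ_a(U) − V(A)»), in real coordinates; here a
DEFINITION (print defines `V(A) = V₃(A) + P₁(A) + P₂(A)` and proves (3.84); read backwards it is the same operator).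
[cite: Balaban1985BackgroundPropagators, (3.82)/(3.84) p.407] -/
def VF (U : CfgY 𝔸 i) (a : AfldY 𝔸 i) : Module.End ℝ (FBondY i × ι → ℝ) :=
  DaF i parS parB GpS b U - DaF i parS parB GpS b (mulY i (fluct (kGeo i).eta a) U)

/-- (3.84) read as an identity of the letters: `Δ_a(U) − V(A) = Δ_a(U′U)`. [cite: Balaban1985BackgroundPropagators, (3.84) p.407] -/
theorem DaF_sub_VF (U : CfgY 𝔸 i) (a : AfldY 𝔸 i) :
    DaF i parS parB GpS b U - VF i parS parB GpS b U a = DaF i parS parB GpS b (mulY i (fluct (kGeo i).eta a) U) := by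
  rw [VF, sub_sub_cancel]

/-- `Δ_a(V)·G(V) = 1` in real coordinates wherever `Δ_a(V)` is invertible ((3.27); Thm 3.3 ∕ 3.11's regime). [cite: Balaban1985BackgroundPropagators, (3.27) p.395] -/
theorem DaF_mul_GbF {V : CfgY 𝔸 i} (hV : IsUnit (deltaAY i parS parB GpS V)) : DaF i parS parB GpS b V * GbF i parS parB GpS b V = 1 := by
  rw [DaF, GbF, ← B9Eq352DivFormLetters.conj_mul, Module.End.mul_eq_comp, ← LinearMap.restrictScalars_comp, ← Module.End.mul_eq_comp,
    deltaAY_mul_GAY i hV]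
  exact conj_one b

/-- `G(V)·Δ_a(V) = 1` in real coordinates wherever `Δ_a(V)` is invertible. [cite: Balaban1985BackgroundPropagators, (3.27) p.395] -/
theorem GbF_mul_DaF {V : CfgY 𝔸 i} (hV : IsUnit (deltaAY i parS parB GpS V)) : GbF i parS parB GpS b V * DaF i parS parB GpS b V = 1 := by
  rw [DaF, GbF, ← B9Eq352DivFormLetters.conj_mul, Module.End.mul_eq_comp, ← LinearMap.restrictScalars_comp, ← Module.End.mul_eq_comp,
    GAY_mul_deltaAY i hV]
  exact conj_one b

/-- ★ **A TWO-SIDED INVERSE OF `Δ_a(W)` IN REAL COORDINATES IS `G(W)`**: if `DaF W = D` and `D·X = 1 = X·D` then `Δ_a(W)` is bijective (conjugation by the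
coordinate equivalence), hence a unit of `End_ℂ`, so `G(W) = Ring.inverse Δ_a(W)` inverts it and `GbF W = X` by uniqueness of two-sided inverses — the
step that identifies the operator `G(U′U)` of (3.86) with «its inverse again by G» of (3.27). (`G′` twin with print's units: gen 7's `B9SectBGpLettersY.gopC_eq`.)
[cite: Balaban1985BackgroundPropagators, (3.27) p.395 + (3.86) p.407] -/
theorem GbF_eq_of_two_sided (W : CfgY 𝔸 i) (D X : Module.End ℝ (FBondY i × ι → ℝ)) (hD : DaF i parS parB GpS b W = D) (hDX : D * X = 1)
    (hXD : X * D = 1) : IsUnit (deltaAY i parS parB GpS W) ∧ GbF i parS parB GpS b W = X := by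
  -- `D` is bijective, hence so is `Δ_a(W)|ℝ = coord⁻¹ ∘ D ∘ coord`, the same function as `Δ_a(W)`
  have hbijD : Function.Bijective D := (Module.End.isUnit_iff D).1 ⟨⟨D, X, hDX, hXD⟩, rfl⟩
  have hbijΔ : Function.Bijective (deltaAY i parS parB GpS W) := by
    have hTe : ((deltaAY i parS parB GpS W) : (FBondY i → 𝔸) → (FBondY i → 𝔸)) = (coordEquiv b).symm ∘ D ∘ (coordEquiv b) := by
      funext f
      have := congrArg (fun L : Module.End ℝ (FBondY i × ι → ℝ) => (coordEquiv b).symm (L (coordEquiv b f))) hD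
      simpa [DaF, B9Eq352DivFormLetters.conj, LinearEquiv.conj_apply] using this
    rw [hTe]
    exact (coordEquiv b).symm.bijective.comp (hbijD.comp (coordEquiv b).bijective)
  have hunit : IsUnit (deltaAY i parS parB GpS W) := (Module.End.isUnit_iff _).2 hbijΔ
  refine ⟨hunit, ?_⟩
  have h1 : D * GbF i parS parB GpS b W = 1 := by rw [← hD]; exact DaF_mul_GbF i parS parB GpS b hunit
  calc GbF i parS parB GpS b W = (X * D) * GbF i parS parB GpS b W := by rw [hXD, one_mul]
    _ = X * (D * GbF i parS parB GpS b W) := by rw [mul_assoc]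
    _ = X := by rw [h1, mul_one]

end Letters

/-! ## §2 The block map of the bond carrier, the two (3.85) majorants, and (3.85) DISPLAYED in the positive-input step shape -/

section Display

variable (x : MemberY d ℓ hd hL b₀ b₁ Mstar) (parS : SiteParY 𝔸 x.toKIdx) (parB : BondParY 𝔸 x.toKIdx) (GpS : SiteOpY 𝔸 x.toKIdx)
  (b : Module.Basis ι ℝ 𝔸) (ιB : BlkY x.toKIdx → IBondY x.toKIdx)

/-- the block map of the real bond carrier: the block of the fine bond, labelled by an index bond through a section `ι_B` of `β` (gen 12's `B9SectBGReadY`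
convention). [cite: Balaban1985BackgroundPropagators, p.397 (𝔅); Balaban1984PropagatorsII, (2.51) p.232] -/
def blkF : FBondY x.toKIdx × ι → (geo9Y x).Site := fun p => ιB (blkV1 x.toKIdx.hN x.toKIdx.D p.1)

/-- **THE TWO (3.85) MAJORANTS AT A CLASS PAIR `(U, e^{iηa})`** with constant `κ·α₁` and rate `ρ`: print's `V(A)G(U) ≺ κα₁e^{−ρd}` and its left twin
`G(U)V(A) ≺ κα₁e^{−ρd}` ([4] (2.51) block majorants on the bond carrier). [cite: Balaban1985BackgroundPropagators, (3.85) p.407; Balaban1984PropagatorsII, (2.51) p.232] -/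
def Maj385F [Fintype (geo9Y x).Site] (κ ρ α₁ : ℝ) (U : CfgY 𝔸 x.toKIdx) (a : AfldY 𝔸 x.toKIdx) : Prop :=
  HasMajorant (g := toB6 (geo9Y x) 0 True) (blkF x ιB) (VF x.toKIdx parS parB GpS b U a * GbF x.toKIdx parS parB GpS b U)
      (fun y y' => κ * α₁ * Real.exp (-(ρ * (geo9Y x).dist y y'))) ∧
    HasMajorant (g := toB6 (geo9Y x) 0 True) (blkF x ιB) (GbF x.toKIdx parS parB GpS b U * VF x.toKIdx parS parB GpS b U a)
      (fun y y' => κ * α₁ * Real.exp (-(ρ * (geo9Y x).dist y y')))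

end Display

section Step385

variable {J : Type} (f : J → MemberY d ℓ hd hL b₀ b₁ Mstar) [∀ x : MemberY d ℓ hd hL b₀ b₁ Mstar, Fintype (geo9Y x).Site]
  (dB : ℕ) (c35 : ℝ) (G : Subgroup 𝔸ˣ) (b : Module.Basis ι ℝ 𝔸)
  (par parS : ∀ j : J, SiteParY 𝔸 (f j).toKIdx) (parB : ∀ j : J, BondParY 𝔸 (f j).toKIdx) (GpS : ∀ j : J, SiteOpY 𝔸 (f j).toKIdx)
  (ιB : ∀ j : J, BlkY (f j).toKIdx → IBondY (f j).toKIdx)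
  (C37 C38 : ∀ j : J, ℝ → CfgY 𝔸 (f j).toKIdx → AfldY 𝔸 (f j).toKIdx → Prop)
  (Cinv : ∀ j : J, B9.SiteKernel (geo9Y (f j)) (bg9Y 𝔸 G (f j)))

/-- ★ **(3.85) AND ITS LEFT TWIN, DISPLAYED IN THE POSITIVE-INPUT STEP SHAPE** for the family `(KSCU, KACU, C⁻¹)` of the Sect.-B step of record over
the coded carrier (`KACU` reading the letter `G(·) = Node00.GAY parS parB GpS`): for every positive input tuple of Theorems 3.1–3.3 there are thresholds
`M₀, a₁, a₀′` and an output `(κ, ρ)`, `κ ≧ 0`, `ρ > 0`, such that at every member above `M₀`, every (3.35)-regular `U` at which Theorems 3.1–3.3 hold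
with the inputs, every `0 < α₁ ≦ a₁` and every `U′ = e^{iηa}` in the class (3.37) (on the coded carrier: the pair `(base U, mult a)`): `V(A)G(U) ≺ κα₁e^{−ρd}` (print's (3.85), with `O(1)` and `½δ₀`
named `κ`, `ρ`) and `G(U)V(A) ≺ κα₁e^{−ρd}` (its left twin, derived in the tree at r06's letters by `B9Ineq386CommSum.hasMajorant_GV_of_gradForm_comm_sum`).
A `Prop` — the HYPOTHESIS `h385` of `stepEPos_KACU_of_385`; nothing asserted. [cite: Balaban1985BackgroundPropagators, (3.85) p.407 («Using the bounds (3.73), (3.77), (3.83) and assuming that Theorem 3.3 holds for G(U), we get …»), Thm 3.4 p.400] -/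
def Step385F : Prop :=
  StepPos dB c35 (fun j => geo9Y (f j)) (fun j => (codingYx G (f j) (C37 j) (C38 j)).bg)
    (fun j => KSCU G (f j) (par j) (C37 j) (C38 j))
    (fun j => KACU G (f j) (GAY (f j).toKIdx (parS j) (parB j) (GpS j)) (parB j) (C37 j) (C38 j))
    (fun j => pullS (codingYx G (f j) (C37 j) (C38 j)) (Cinv j)) (ℝ × ℝ) (fun c => 0 ≤ c.1 ∧ 0 < c.2)
    (fun c j U α₁ => ∀ U' : (codingYx G (f j) (C37 j) (C38 j)).bg.Cfg, (codingYx G (f j) (C37 j) (C38 j)).bg.Cplx337 α₁ U U' →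
      ∀ (U₀ : CfgY 𝔸 (f j).toKIdx) (a : AfldY 𝔸 (f j).toKIdx), U = .base U₀ → U' = .mult a →
        Maj385F (f j) (parS j) (parB j) (GpS j) b (ιB j) c.1 c.2 α₁ U₀ a)

end Step385

/-! ## §3 ★★ The (3.42) block of `KACU` at a coded product from (3.85): ONE configuration, explicit constants -/

section Core

variable (G : Subgroup 𝔸ˣ) (x : MemberY d ℓ hd hL b₀ b₁ Mstar) (parS : SiteParY 𝔸 x.toKIdx) (parB : BondParY 𝔸 x.toKIdx) (GpS : SiteOpY 𝔸 x.toKIdx)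
  (b : Module.Basis ι ℝ 𝔸) (ιB : BlkY x.toKIdx → IBondY x.toKIdx) (C37 C38 : ℝ → CfgY 𝔸 x.toKIdx → AfldY 𝔸 x.toKIdx → Prop)

omit [NormedAlgebra ℂ 𝔸] [CompleteSpace 𝔸] [Fintype ι] in
/-- majorant bookkeeping: `A·P(a)·e^{−rd} ≦ A′·P(a)·e^{−r′d}` for `A ≦ A′`, `0 ≦ A′`, `r′ ≦ r`, `P, d ≧ 0`. [folklore] [cite: Balaban1984PropagatorsII, (2.51) p.232] -/
private theorem maj_reshape [Fintype (geo9Y x).Site] {X : Type} (blk : X → (geo9Y x).Site) {T : Module.End ℝ (X → ℝ)}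
    {A A' r r' : ℝ} (P : (geo9Y x).Site → ℝ) (hP : ∀ a, 0 ≤ P a) (hA : A ≤ A') (hA' : 0 ≤ A') (hr : r' ≤ r)
    (h : HasMajorant (g := toB6 (geo9Y x) 0 True) blk T (fun a a' => A * P a * Real.exp (-(r * (geo9Y x).dist a a')))) :
    HasMajorant (g := toB6 (geo9Y x) 0 True) blk T (fun a a' => A' * P a * Real.exp (-(r' * (geo9Y x).dist a a'))) := by
  refine hasMajorant_mono (g := toB6 (geo9Y x) 0 True) blk h fun a a' => ?_
  have hd : 0 ≤ (geo9Y x).dist a a' := geo9Y_dist_nonneg x a a'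
  have he : Real.exp (-(r * (geo9Y x).dist a a')) ≤ Real.exp (-(r' * (geo9Y x).dist a a')) :=
    Real.exp_le_exp.2 (by nlinarith)
  calc A * P a * Real.exp (-(r * (geo9Y x).dist a a'))
      ≤ A' * P a * Real.exp (-(r * (geo9Y x).dist a a')) :=
        mul_le_mul_of_nonneg_right (mul_le_mul_of_nonneg_right hA (hP a)) (Real.exp_pos _).le
    _ ≤ A' * P a * Real.exp (-(r' * (geo9Y x).dist a a')) := mul_le_mul_of_nonneg_left he (mul_nonneg hA' (hP a))

/-- ★★ **THE (3.42) BLOCK OF `G(U′U)` READ BY `KACU` AT THE CODED PRODUCT, FROM (3.85) — ONE CONFIGURATION, EXPLICIT CONSTANTS.**  Data: a base `U` with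
`Δ_a(U)` invertible; Theorem 3.3's (3.42) block of `KACU` at `base U` with `(B₀, δ₀)`; the two (3.85) majorants at `(U, a)` with `(κα₁, ρ)`; [4] (2.61) and
the scale transfer of `Lʲη` at the common rate `ρ₀ = min ρ δ₀` and an exponent `0 ≦ α′ ≦ 1/3` with constant `Λ ≧ 1`; the smallness `κα₁c₁(α′) ≦ ½`
(«for α₁ sufficiently small»).  Conclusion: `EBlock KACU (M₂Σ‖b‖·(2(M₂Σ‖b‖B₀)Λ²(c₁+1))) ((1−3α′)ρ₀) (prod U a)` and `IsUnit Δ_a(e^{iηa}U)`.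
Proof = print's p. 407: READ the four majorants of `G(U)`, `∇_νG(U)`, `G(U)∇*_ν`, `Δ_UG(U)` from the block (gen 12 `readG342Y_KACU`), (3.84) ⇒ (3.86)
(`exists_gExt_of_385`: the two-sided inverse `G̃` of `Δ_a(U) − V(A) = Δ_a(U′U)` with both resolvent identities), `G̃ = G(U′U)` (`GbF_eq_of_two_sided`),
[4] (2.66) for the three left entries (`gExt_leftEntry_of_386`) and the right entry (`gExt_rightEntry_of_386L`, the twin), then WRITE the block at the coded
product (gen 12 `writeG342Y_KACU`: U-letter differences at the base, operator at the product — R13-U1).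
[cite: Balaban1985BackgroundPropagators, Thm 3.4 p.400 + (3.84)–(3.86) p.407 + Thm 3.3 (3.42) pp.397/399 + (3.27) p.395; Balaban1984PropagatorsII, (2.66) p.234 + Lemma 2.1 p.234 + (2.51) p.232] -/
theorem eBlock_KACU_prod_of_385 [Fintype (geo9Y x).Site] [DecidableEq ι]
    (hι : ∀ s, β x.toKIdx.hN x.toKIdx.D x.toKIdx.hk (ιB s) = s)
    {M₂ : ℝ} (hM₂ : 0 ≤ M₂) (hrepr : ∀ (v : 𝔸) (j : ι), |b.repr v j| ≤ M₂ * ‖v‖)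
    {U : CfgY 𝔸 x.toKIdx} {a : AfldY 𝔸 x.toKIdx} (hunit : IsUnit (deltaAY x.toKIdx parS parB GpS U))
    {B₀ δ₀ κ ρ α₁ α' Λ : ℝ} (d₂ : ℕ) (hB₀ : 0 < B₀) (hδ₀ : 0 < δ₀) (hκ : 0 ≤ κ) (hρ : 0 < ρ) (hα₁ : 0 ≤ α₁)
    (hα'0 : 0 ≤ α') (hα'3 : 3 * α' ≤ 1) (hΛ : 1 ≤ Λ)
    (h261 : Ineq261 d₂ (toB6 (geo9Y x) 0 True) (min ρ δ₀) α')
    (hST : ScaleTransfer (geo9Y x) (min ρ δ₀) α' Λ (fun y => (geo9Y x).len y))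
    (hsmall : κ * α₁ * B6.c1 d₂ (min ρ δ₀) α' ≤ 1 / 2)
    (hE : EBlock (KACU G x (GAY x.toKIdx parS parB GpS) parB C37 C38) B₀ δ₀ (.base U))
    (hVG : HasMajorant (g := toB6 (geo9Y x) 0 True) (blkF x ιB)
      (VF x.toKIdx parS parB GpS b U a * GbF x.toKIdx parS parB GpS b U) (fun y y' => κ * α₁ * Real.exp (-(ρ * (geo9Y x).dist y y'))))
    (hGV : HasMajorant (g := toB6 (geo9Y x) 0 True) (blkF x ιB)
      (GbF x.toKIdx parS parB GpS b U * VF x.toKIdx parS parB GpS b U a) (fun y y' => κ * α₁ * Real.exp (-(ρ * (geo9Y x).dist y y')))) :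
    EBlock (KACU G x (GAY x.toKIdx parS parB GpS) parB C37 C38)
        (M₂ * (∑ j, ‖b j‖) * (2 * (M₂ * (∑ j, ‖b j‖) * B₀) * Λ ^ 2 * (B6.c1 d₂ (min ρ δ₀) α' + 1))) ((1 - 3 * α') * min ρ δ₀) (.prod U a) ∧
      IsUnit (deltaAY x.toKIdx parS parB GpS (mulY x.toKIdx (fluct (kGeo x.toKIdx).eta a) U)) := by
  classical
  letI : Fintype (geo9K x.toKIdx).Site := ‹Fintype (geo9Y x).Site›
  -- names
  set W := mulY x.toKIdx (fluct (kGeo x.toKIdx).eta a) U with hW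
  set ρ₀ := min ρ δ₀ with hρ₀
  set c₁ := B6.c1 d₂ ρ₀ α' with hc₁
  set θ := κ * α₁ with hθ
  set Bl := M₂ * (∑ j, ‖b j‖) * B₀ with hBl
  set GU := GbF x.toKIdx parS parB GpS b U with hGU
  set V := VF x.toKIdx parS parB GpS b U a with hV
  set Δa := DaF x.toKIdx parS parB GpS b U with hΔa
  -- the geometry of record
  have hdnn : ∀ y y' : (geo9Y x).Site, 0 ≤ (geo9Y x).dist y y' := geo9Y_dist_nonneg x
  have htri : Triangle254 (toB6 (geo9Y x) 0 True) := fun p q r => geo9Y_dist_triangle x p q r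
  have hrefl : ∀ y : (geo9Y x).Site, (geo9Y x).dist y y = 0 := geo9Y_dist_self x
  have hsym : ∀ y y' : (geo9Y x).Site, (geo9Y x).dist y y' = (geo9Y x).dist y' y := geo9Y_dist_comm x
  have hlen : ∀ y : (geo9Y x).Site, 0 < (geo9Y x).len y := geo9K_len_pos x.toKIdx
  -- signs
  have hSb : 0 ≤ ∑ j, ‖b j‖ := Finset.sum_nonneg fun j _ => norm_nonneg _
  have hM₂S : 0 ≤ M₂ * ∑ j, ‖b j‖ := mul_nonneg hM₂ hSb
  have hBl0 : 0 ≤ Bl := mul_nonneg hM₂S hB₀.le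
  have hρ₀ : 0 < ρ₀ := lt_min hρ hδ₀
  have hρ₀ρ : ρ₀ ≤ ρ := min_le_left _ _
  have hρ₀δ : ρ₀ ≤ δ₀ := min_le_right _ _
  have hθ0 : 0 ≤ θ := mul_nonneg hκ hα₁
  have hc₁0 : 0 ≤ c₁ := B6RandomWalk.c1_nonneg _ _ _
  have hα'1 : α' ≤ 1 := by linarith
  have hα'ρ : 0 ≤ (1 - α') * ρ₀ := mul_nonneg (by linarith) hρ₀.le
  have hα'ρ1 : 0 ≤ α' * ρ₀ := mul_nonneg hα'0 hρ₀.le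
  have hα'ρ2 : 0 ≤ (1 - 2 * α') * ρ₀ := mul_nonneg (by linarith) hρ₀.le
  have hsmall' : θ * c₁ < 1 := lt_of_le_of_lt hsmall (by norm_num)
  have hinv2 : (1 - θ * c₁)⁻¹ ≤ 2 := by
    have h1 : (1 : ℝ) / 2 ≤ 1 - θ * c₁ := by linarith
    calc (1 - θ * c₁)⁻¹ ≤ ((1 : ℝ) / 2)⁻¹ := inv_anti₀ (by norm_num) h1
      _ = 2 := by norm_num
  have hinv0 : 0 ≤ (1 - θ * c₁)⁻¹ := inv_nonneg.2 (by linarith)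
  have hΛ0 : 0 ≤ Λ := zero_le_one.trans hΛ
  have hΛ2 : 1 ≤ Λ ^ 2 := one_le_pow₀ hΛ
  -- (3.27) at the base: `Δ_a(U)G(U) = G(U)Δ_a(U) = 1`
  have hΔG : Δa * GU = 1 := DaF_mul_GbF x.toKIdx parS parB GpS b hunit
  have hGΔ : GU * Δa = 1 := GbF_mul_DaF x.toKIdx parS parB GpS b hunit
  -- READ: the four majorants of `G(U)` from Theorem 3.3's block, lowered to the common rate `ρ₀`
  obtain ⟨h0, h1, h2, h3⟩ := readG342Y_KACU (Rr := (0 : ℝ)) (Hp := True) (b := b) (G := G) (x := x) (OA := GAY x.toKIdx parS parB GpS) (parB := parB)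
      (C37 := C37) (C38 := C38) (ιB := ιB) hι hM₂ hrepr hB₀.le hE
  have h0' : HasMajorant (g := toB6 (geo9Y x) 0 True) (blkF x ιB) (1 * GU) (fun y y' => Bl * (geo9Y x).len y ^ 2 * Real.exp (-(ρ₀ * (geo9Y x).dist y y'))) := by
    rw [one_mul]
    refine maj_reshape x (blkF x ιB) (fun y => (geo9Y x).len y ^ 2) (fun y => sq_nonneg _) le_rfl hBl0 hρ₀δ
      (hasMajorant_mono (g := toB6 (geo9Y x) 0 True) (blkF x ιB) h0 fun y y' => le_of_eq (by rw [hBl]; unfold geo9Y; ring))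
  have h1' : ∀ ν : Fin (d + 1), HasMajorant (g := toB6 (geo9Y x) 0 True) (blkF x ιB) (conj b (cdBₗ x.toKIdx U ν) * GU)
      (fun y y' => Bl * (geo9Y x).len y * Real.exp (-(ρ₀ * (geo9Y x).dist y y'))) := fun ν => by
    rw [hGU, GbF, ← B9Eq352DivFormLetters.conj_mul]
    refine maj_reshape x (blkF x ιB) (fun y => (geo9Y x).len y) (fun y => (hlen y).le) le_rfl hBl0 hρ₀δ
      (hasMajorant_mono (g := toB6 (geo9Y x) 0 True) (blkF x ιB) (h1 ν) fun y y' => le_of_eq (by rw [hBl]; unfold geo9Y; ring))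
  have h2' : ∀ ν : Fin (d + 1), HasMajorant (g := toB6 (geo9Y x) 0 True) (blkF x ιB) (GU * conj b (cdsBₗ x.toKIdx U ν))
      (fun y y' => Bl * (geo9Y x).len y * Real.exp (-(ρ₀ * (geo9Y x).dist y y'))) := fun ν => by
    rw [hGU, GbF, ← B9Eq352DivFormLetters.conj_mul]
    refine maj_reshape x (blkF x ιB) (fun y => (geo9Y x).len y) (fun y => (hlen y).le) le_rfl hBl0 hρ₀δ
      (hasMajorant_mono (g := toB6 (geo9Y x) 0 True) (blkF x ιB) (h2 ν) fun y y' => le_of_eq (by rw [hBl]; unfold geo9Y; ring))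
  have h3' : HasMajorant (g := toB6 (geo9Y x) 0 True) (blkF x ιB) (conj b (lapBₗ x.toKIdx U) * GU) (fun y y' => Bl * 1 * Real.exp (-(ρ₀ * (geo9Y x).dist y y'))) := by
    rw [hGU, GbF, ← B9Eq352DivFormLetters.conj_mul]
    refine maj_reshape x (blkF x ιB) (fun _ => (1 : ℝ)) (fun _ => zero_le_one) le_rfl hBl0 hρ₀δ
      (hasMajorant_mono (g := toB6 (geo9Y x) 0 True) (blkF x ιB) h3 fun y y' => le_of_eq (by rw [hBl]; unfold geo9Y; ring))
  -- the two (3.85) majorants at the common rate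
  have hVG' : HasMajorant (g := toB6 (geo9Y x) 0 True) (blkF x ιB) (V * GU) (fun y y' => θ * Real.exp (-(ρ₀ * (geo9Y x).dist y y'))) := by
    have := maj_reshape x (blkF x ιB) (fun _ => (1 : ℝ)) (fun _ => zero_le_one) le_rfl hθ0 hρ₀ρ
      (hasMajorant_mono (g := toB6 (geo9Y x) 0 True) (blkF x ιB) hVG fun y y' => le_of_eq (by rw [hθ]; ring))
    exact hasMajorant_mono (g := toB6 (geo9Y x) 0 True) (blkF x ιB) this fun y y' => le_of_eq (by ring)
  have hGV' : HasMajorant (g := toB6 (geo9Y x) 0 True) (blkF x ιB) (GU * V) (fun y y' => θ * Real.exp (-(ρ₀ * (geo9Y x).dist y y'))) := by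
    have := maj_reshape x (blkF x ιB) (fun _ => (1 : ℝ)) (fun _ => zero_le_one) le_rfl hθ0 hρ₀ρ
      (hasMajorant_mono (g := toB6 (geo9Y x) 0 True) (blkF x ιB) hGV fun y y' => le_of_eq (by rw [hθ]; ring))
    exact hasMajorant_mono (g := toB6 (geo9Y x) 0 True) (blkF x ιB) this fun y y' => le_of_eq (by ring)
  -- (3.84) ⟹ (3.86): the two-sided inverse `G̃` of `Δ_a(U) − V(A) = Δ_a(U′U)`, with both resolvent identities
  obtain ⟨GExt, h386L, h386R, hinvL, hinvR⟩ :=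
    exists_gExt_of_385 (R := (0 : ℝ)) (H := True) (blkF x ιB) d₂ ρ₀ α' θ hθ0 hα'ρ hdnn h261 hsmall' Δa GU V hΔG hGΔ hVG'
  rw [hΔa, hV, DaF_sub_VF] at hinvL hinvR
  -- `G̃ = G(U′U)` and `Δ_a(U′U)` is invertible
  obtain ⟨hunitW, hGbW⟩ := GbF_eq_of_two_sided x.toKIdx parS parB GpS b W _ GExt rfl hinvL hinvR
  refine ⟨?_, hunitW⟩
  -- [4] (2.66): the three left entries and the right entry of `G̃`
  have hL0 := gExt_leftEntry_of_386 (R := (0 : ℝ)) (H := True) (blkF x ιB) d₂ ρ₀ α' θ Bl (fun y => (geo9Y x).len y ^ 2) hBl0 (fun y => sq_nonneg _) hθ0 hρ₀.le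
    hα'1 hα'ρ htri hrefl hdnn h261 hsmall' h0' hVG' h386R
  have hL1 := fun ν : Fin (d + 1) => gExt_leftEntry_of_386 (R := (0 : ℝ)) (H := True) (blkF x ιB) d₂ ρ₀ α' θ Bl (fun y => (geo9Y x).len y) hBl0
    (fun y => (hlen y).le) hθ0 hρ₀.le hα'1 hα'ρ htri hrefl hdnn h261 hsmall' (h1' ν) hVG' h386R
  have hL3 := gExt_leftEntry_of_386 (R := (0 : ℝ)) (H := True) (blkF x ιB) d₂ ρ₀ α' θ Bl (fun _ => (1 : ℝ)) hBl0 (fun _ => zero_le_one) hθ0 hρ₀.le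
    hα'1 hα'ρ htri hrefl hdnn h261 hsmall' h3' hVG' h386R
  have hR2 := fun ν : Fin (d + 1) => gExt_rightEntry_of_386L (R := (0 : ℝ)) (H := True) (blkF x ιB) d₂ ρ₀ α' θ Bl Λ (fun y => (geo9Y x).len y) hBl0 hΛ0
    (fun y => (hlen y).le) hθ0 hρ₀.le hα'1 hα'ρ1 hα'ρ2 htri hrefl hsym hdnn h261 hsmall' hST (h2' ν) hGV' h386L
  -- one common constant `2·Bl·Λ²·(c₁+1)` and the rate `(1−3α′)ρ₀`
  set Bc := 2 * Bl * Λ ^ 2 * (c₁ + 1) with hBc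
  have hBc0 : 0 ≤ Bc := by positivity
  have hcoefL : Bl * c₁ * (1 - θ * c₁)⁻¹ ≤ Bc := by
    calc Bl * c₁ * (1 - θ * c₁)⁻¹ ≤ Bl * c₁ * 2 := mul_le_mul_of_nonneg_left hinv2 (mul_nonneg hBl0 hc₁0)
      _ = 2 * Bl * 1 * c₁ := by ring
      _ ≤ 2 * Bl * Λ ^ 2 * (c₁ + 1) := by
          apply mul_le_mul (mul_le_mul_of_nonneg_left hΛ2 (by positivity)) (by linarith) hc₁0 (by positivity)
  have hcoefR : Bl * Λ ^ 2 * c₁ * (1 - θ * c₁)⁻¹ ≤ Bc := by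
    calc Bl * Λ ^ 2 * c₁ * (1 - θ * c₁)⁻¹ ≤ Bl * Λ ^ 2 * c₁ * 2 := mul_le_mul_of_nonneg_left hinv2 (by positivity)
      _ = 2 * Bl * Λ ^ 2 * c₁ := by ring
      _ ≤ 2 * Bl * Λ ^ 2 * (c₁ + 1) := mul_le_mul_of_nonneg_left (by linarith) (by positivity)
  have hrateL : (1 - 3 * α') * ρ₀ ≤ (1 - α') * ρ₀ := mul_le_mul_of_nonneg_right (by linarith) hρ₀.le
  have hG0 : HasMajorant (g := toB6 (geo9Y x) 0 True) (blkF x ιB) GExt (fun y y' => Bc * (geo9Y x).len y ^ 2 * Real.exp (-((1 - 3 * α') * ρ₀ * (geo9Y x).dist y y'))) := by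
    rw [one_mul] at hL0
    exact maj_reshape x (blkF x ιB) (fun y => (geo9Y x).len y ^ 2) (fun y => sq_nonneg _) hcoefL hBc0 hrateL hL0
  have hG1 : ∀ ν : Fin (d + 1), HasMajorant (g := toB6 (geo9Y x) 0 True) (blkF x ιB) (conj b (cdBₗ x.toKIdx U ν) * GExt)
      (fun y y' => Bc * (geo9Y x).len y * Real.exp (-((1 - 3 * α') * ρ₀ * (geo9Y x).dist y y'))) := fun ν =>
    maj_reshape x (blkF x ιB) (fun y => (geo9Y x).len y) (fun y => (hlen y).le) hcoefL hBc0 hrateL (hL1 ν)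
  have hG2 : ∀ ν : Fin (d + 1), HasMajorant (g := toB6 (geo9Y x) 0 True) (blkF x ιB) (GExt * conj b (cdsBₗ x.toKIdx U ν))
      (fun y y' => Bc * (geo9Y x).len y * Real.exp (-((1 - 3 * α') * ρ₀ * (geo9Y x).dist y y'))) := fun ν =>
    maj_reshape x (blkF x ιB) (fun y => (geo9Y x).len y) (fun y => (hlen y).le) hcoefR hBc0 le_rfl (hR2 ν)
  have hG3 : HasMajorant (g := toB6 (geo9Y x) 0 True) (blkF x ιB) (conj b (lapBₗ x.toKIdx U) * GExt)
      (fun y y' => Bc * 1 * Real.exp (-((1 - 3 * α') * ρ₀ * (geo9Y x).dist y y'))) :=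
    maj_reshape x (blkF x ιB) (fun _ => (1 : ℝ)) (fun _ => zero_le_one) hcoefL hBc0 hrateL hL3
  -- WRITE the block of `KACU` at the coded product: the operator at `W = e^{iηa}U` is `G(W)`, whose real coordinates are `G̃`
  have hGb : conj b ((GAY x.toKIdx parS parB GpS W).restrictScalars ℝ) = GExt := hGbW
  refine writeG342Y_KACU (Rr := (0 : ℝ)) (Hp := True) (b := b) (G := G) (x := x) (OA := GAY x.toKIdx parS parB GpS) (parB := parB)
    (C37 := C37) (C38 := C38) (ιB := ιB) hι hM₂ hrepr U a
    ((GAY x.toKIdx parS parB GpS W).restrictScalars ℝ) (fun Λ' => rfl) (fun ν => cdBₗ x.toKIdx U ν) (fun ν => cdsBₗ x.toKIdx U ν)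
    (fun ν Λ' => rfl) (fun ν Λ' => rfl) (lapBₗ x.toKIdx U) (fun Λ' => lapBₗ_apply x.toKIdx U Λ') hBc0 ?_ ?_ ?_ ?_
  · rw [hGb]; exact hG0
  · intro ν; rw [hGb]; exact hG1 ν
  · intro ν; rw [hGb]; exact hG2 ν
  · rw [hGb]; exact hG3

/-- **The analytic-extension clause for `G`** at a class product, from (3.85): `Δ_a(U′U)·G(U′U) = 1 = G(U′U)·Δ_a(U′U)` («the operators … G(U) extend to
configurations U′U», Thm 3.4) — the inverse the Neumann series (3.86) produces is NODE 00's `GAY (U′U)`.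
[cite: Balaban1985BackgroundPropagators, Thm 3.4 p.400 + (3.86) p.407 + (3.27) p.395] -/
theorem GAY_inv_prod_of_385 [Fintype (geo9Y x).Site] [DecidableEq ι]
    (hι : ∀ s, β x.toKIdx.hN x.toKIdx.D x.toKIdx.hk (ιB s) = s)
    {M₂ : ℝ} (hM₂ : 0 ≤ M₂) (hrepr : ∀ (v : 𝔸) (j : ι), |b.repr v j| ≤ M₂ * ‖v‖)
    {U : CfgY 𝔸 x.toKIdx} {a : AfldY 𝔸 x.toKIdx} (hunit : IsUnit (deltaAY x.toKIdx parS parB GpS U))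
    {B₀ δ₀ κ ρ α₁ α' Λ : ℝ} (d₂ : ℕ) (hB₀ : 0 < B₀) (hδ₀ : 0 < δ₀) (hκ : 0 ≤ κ) (hρ : 0 < ρ) (hα₁ : 0 ≤ α₁)
    (hα'0 : 0 ≤ α') (hα'3 : 3 * α' ≤ 1) (hΛ : 1 ≤ Λ)
    (h261 : Ineq261 d₂ (toB6 (geo9Y x) 0 True) (min ρ δ₀) α')
    (hST : ScaleTransfer (geo9Y x) (min ρ δ₀) α' Λ (fun y => (geo9Y x).len y))
    (hsmall : κ * α₁ * B6.c1 d₂ (min ρ δ₀) α' ≤ 1 / 2)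
    (hE : EBlock (KACU G x (GAY x.toKIdx parS parB GpS) parB C37 C38) B₀ δ₀ (.base U))
    (hVG : HasMajorant (g := toB6 (geo9Y x) 0 True) (blkF x ιB)
      (VF x.toKIdx parS parB GpS b U a * GbF x.toKIdx parS parB GpS b U) (fun y y' => κ * α₁ * Real.exp (-(ρ * (geo9Y x).dist y y'))))
    (hGV : HasMajorant (g := toB6 (geo9Y x) 0 True) (blkF x ιB)
      (GbF x.toKIdx parS parB GpS b U * VF x.toKIdx parS parB GpS b U a) (fun y y' => κ * α₁ * Real.exp (-(ρ * (geo9Y x).dist y y')))) :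
    deltaAY x.toKIdx parS parB GpS (mulY x.toKIdx (fluct (kGeo x.toKIdx).eta a) U) *
        GAY x.toKIdx parS parB GpS (mulY x.toKIdx (fluct (kGeo x.toKIdx).eta a) U) = 1 ∧
      GAY x.toKIdx parS parB GpS (mulY x.toKIdx (fluct (kGeo x.toKIdx).eta a) U) *
        deltaAY x.toKIdx parS parB GpS (mulY x.toKIdx (fluct (kGeo x.toKIdx).eta a) U) = 1 := by
  have hW := (eBlock_KACU_prod_of_385 G x parS parB GpS b ιB C37 C38 hι hM₂ hrepr hunit d₂ hB₀ hδ₀ hκ hρ hα₁ hα'0 hα'3 hΛ h261 hST hsmall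
    hE hVG hGV).2
  exact ⟨deltaAY_mul_GAY x.toKIdx hW, GAY_mul_deltaAY x.toKIdx hW⟩

end Core

/-! ## §4 ★★★ The positive-input (3.42)-step for `KACU` over the coded carrier, from the displayed (3.85) -/

section Step

variable {J : Type} (f : J → MemberY d ℓ hd hL b₀ b₁ Mstar) [∀ x : MemberY d ℓ hd hL b₀ b₁ Mstar, Fintype (geo9Y x).Site]
  (dB : ℕ) (c35 : ℝ) (G : Subgroup 𝔸ˣ) (b : Module.Basis ι ℝ 𝔸)
  (par parS : ∀ j : J, SiteParY 𝔸 (f j).toKIdx) (parB : ∀ j : J, BondParY 𝔸 (f j).toKIdx) (GpS : ∀ j : J, SiteOpY 𝔸 (f j).toKIdx)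
  (ιB : ∀ j : J, BlkY (f j).toKIdx → IBondY (f j).toKIdx)
  (C37 C38 : ∀ j : J, ℝ → CfgY 𝔸 (f j).toKIdx → AfldY 𝔸 (f j).toKIdx → Prop)
  (Cinv : ∀ j : J, B9.SiteKernel (geo9Y (f j)) (bg9Y 𝔸 G (f j)))

/-- ★★★ **THE POSITIVE-INPUT (3.42)-STEP `StepEPos` FOR THE BOND-SECTOR FAMILY `KACU` OF THE SECT.-B STEP OF RECORD (print's reading R13-U1), FROM THE
DISPLAYED (3.85)** — the `hEa` slot of `B9SectBStepWhole.sectBStepPrinted_of_posBlockSteps` for `SectBStepU`: for every positive input tuple of Theorems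
3.1–3.3 there are thresholds `M₀, a₁, a₀′` and positive output constants `(B, δ)` such that at every member above `M₀`, every (3.35)-regular base `U` at
which Theorems 3.1–3.3 hold with the inputs, every `0 < α₁ ≦ a₁` and every `U′ = e^{iηa}` in the class (3.37), the (3.42) block `EBlock KACU B δ (U′U)`
holds.  Structural binders: `hι` (the block labels are a section of `β`), `hM₂`∕`hrepr`∕`hcR` (real coordinates of `𝔸`); DISPLAYED: `hunitA` (Thm 3.3 ∕
3.11: `Δ_a(U)` invertible at `G`-valued `U`) and `h385 : Step385F …` ((3.85) and its left twin).  Thresholds: `M₀ = max(M₁, M₂₆₁(ρ₀), 400·log L∕ρ₀)`,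
`a₁′ = min(a₁, (2(κ+1)(c₁+1))⁻¹)`, `α′ = 1/100`, output `(M₂Σ‖b‖·2(M₂Σ‖b‖B₀)L⁸(c₁+1), (97/100)ρ₀)`, `ρ₀ = min ρ δ₀`.
[cite: Balaban1985BackgroundPropagators, Thm 3.4 p.400 + Sect. B (3.84)–(3.86) p.407 + Thm 3.3 p.399 + (3.42) p.397; Balaban1984PropagatorsII, Lemma 2.1 p.234 + (2.66) p.234] -/
theorem stepEPos_KACU_of_385 [DecidableEq ι]
    (hι : ∀ (j : J) (s : BlkY (f j).toKIdx), β (f j).toKIdx.hN (f j).toKIdx.D (f j).toKIdx.hk (ιB j s) = s)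
    {M₂ : ℝ} (hM₂ : 0 ≤ M₂) (hrepr : ∀ (v : 𝔸) (j : ι), |b.repr v j| ≤ M₂ * ‖v‖) (hcR : 0 < M₂ * ∑ j, ‖b j‖)
    (hunitA : ∀ j (U : CfgY 𝔸 (f j).toKIdx), GVal G (f j).toKIdx U → IsUnit (deltaAY (f j).toKIdx (parS j) (parB j) (GpS j) U))
    (h385 : Step385F f dB c35 G b par parS parB GpS ιB C37 C38 Cinv) :
    StepEPos dB c35 (fun j => geo9Y (f j)) (fun j => (codingYx G (f j) (C37 j) (C38 j)).bg)
      (fun j => KSCU G (f j) (par j) (C37 j) (C38 j))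
      (fun j => KACU G (f j) (GAY (f j).toKIdx (parS j) (parB j) (GpS j)) (parB j) (C37 j) (C38 j))
      (fun j => pullS (codingYx G (f j) (C37 j) (C38 j)) (Cinv j))
      (fun j => KACU G (f j) (GAY (f j).toKIdx (parS j) (parB j) (GpS j)) (parB j) (C37 j) (C38 j)) := by
  classical
  intro B₀ δ₀ Bβ Bε Bεβ B₁ δ₁ hB₀ hδ₀ hB₁ hδ₁
  obtain ⟨M₁, a₁, a₀', ⟨κ, ρ⟩, hM₁, ha₁, ha₀', ⟨hκ, hρ⟩, H385⟩ := h385 B₀ δ₀ Bβ Bε Bεβ B₁ δ₁ hB₀ hδ₀ hB₁ hδ₁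
  -- the (2.61) supplier and the common rate
  obtain ⟨d261, M261, h261⟩ := exists_d261 (d := d) (ℓ := ℓ) (hd := hd) (hL := hL) (b₀ := b₀) (b₁ := b₁) (Mstar := Mstar)
  set ρ₀ := min ρ δ₀ with hρ₀
  have hρ₀pos : 0 < ρ₀ := lt_min hρ hδ₀
  set c₁ := B6.c1 (d261 ρ₀) ρ₀ (1 / 100) with hc₁
  have hc₁0 : 0 ≤ c₁ := B6RandomWalk.c1_nonneg _ _ _
  set Λ : ℝ := ((ℓ : ℝ) + 1) ^ 4 with hΛ
  have hΛ1 : 1 ≤ Λ := one_le_pow₀ (by have : (0 : ℝ) ≤ ℓ := Nat.cast_nonneg _; linarith)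
  have hSb : 0 ≤ ∑ j, ‖b j‖ := Finset.sum_nonneg fun j _ => norm_nonneg _
  -- thresholds and output
  set a₁' := min a₁ (1 / (2 * ((κ + 1) * (c₁ + 1)))) with ha₁'
  have hkc : 0 < (κ + 1) * (c₁ + 1) := by positivity
  have ha₁'pos : 0 < a₁' := lt_min ha₁ (by positivity)
  set Bout := M₂ * (∑ j, ‖b j‖) * (2 * (M₂ * (∑ j, ‖b j‖) * B₀) * Λ ^ 2 * (c₁ + 1)) with hBout
  have hBout : 0 < Bout := by positivity
  set κlo := 1 / 100 * ρ₀ with hκlo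
  have hκlo0 : 0 < κlo := by positivity
  refine ⟨max M₁ (max (M261 ρ₀) (4 * Real.log ((ℓ : ℝ) + 1) / κlo)), a₁', a₀', (Bout, (1 - 3 * (1 / 100)) * ρ₀),
    lt_max_of_lt_left hM₁, ha₁'pos, ha₀', ⟨hBout, by positivity⟩, ?_⟩
  intro j hM α₀ hα₀ hMa c hreg hT α₁ hα₁ hα₁a c' h37
  have hM1 : M₁ ≤ (geo9Y (f j)).M := le_trans (le_max_left _ _) hM
  have hM2 : M261 ρ₀ ≤ (geo9Y (f j)).M := le_trans (le_trans (le_max_left _ _) (le_max_right _ _)) hM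
  have hM3 : 4 * Real.log ((ℓ : ℝ) + 1) / κlo ≤ (geo9Y (f j)).M := le_trans (le_trans (le_max_right _ _) (le_max_right _ _)) hM
  have hα₁1 : α₁ ≤ a₁ := le_trans hα₁a (min_le_left _ _)
  -- the base and the class pair
  obtain ⟨U, rfl, hU⟩ := (codingYx G (f j) (C37 j) (C38 j)).exists_of_bg_Reg335 hreg
  obtain ⟨U', a, hcU, rfl, hC⟩ := (codingYx G (f j) (C37 j) (C38 j)).exists_of_bg_Cplx337 h37
  cases hcU
  -- the two (3.85) majorants at `(U, a)` and Theorem 3.3's block at the base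
  have h85 : Maj385F (f j) (parS j) (parB j) (GpS j) b (ιB j) κ ρ α₁ U a := H385 j hM1 α₀ hα₀ hMa _ hreg hT α₁ hα₁ hα₁1 _ h37 U a rfl rfl
  have hE : EBlock (KACU G (f j) (GAY (f j).toKIdx (parS j) (parB j) (GpS j)) (parB j) (C37 j) (C38 j)) B₀ δ₀ (.base U) := hT.2.2.1.1
  -- Lemma 2.1 and the scale transfer at `(ρ₀, 1/100)`; the smallness
  have h261j : Ineq261 (d261 ρ₀) (toB6 (geo9Y (f j)) 0 True) ρ₀ (1 / 100) :=
    h261 (f j) ρ₀ (1 / 100) hρ₀pos (by norm_num) (by norm_num) hM2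
  have hSTj : ScaleTransfer (geo9Y (f j)) ρ₀ (1 / 100) Λ (fun y => (geo9Y (f j)).len y) :=
    (scaleTransfer6_window_geo9Y hκlo0 (f j) (δ := ρ₀) (α := 1 / 100) le_rfl hM3).1
  have hsmall : κ * α₁ * c₁ ≤ 1 / 2 := by
    have hα₁2 : α₁ ≤ 1 / (2 * ((κ + 1) * (c₁ + 1))) := le_trans hα₁a (min_le_right _ _)
    have hκc : κ * c₁ ≤ (κ + 1) * (c₁ + 1) := by nlinarith
    calc κ * α₁ * c₁ = κ * c₁ * α₁ := by ring
      _ ≤ (κ + 1) * (c₁ + 1) * (1 / (2 * ((κ + 1) * (c₁ + 1)))) :=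
          mul_le_mul hκc hα₁2 hα₁.le hkc.le
      _ = 1 / 2 := by field_simp
  -- the one-configuration theorem
  exact (eBlock_KACU_prod_of_385 G (f j) (parS j) (parB j) (GpS j) b (ιB j) (C37 j) (C38 j) (hι j) hM₂ hrepr (hunitA j U hU.1.1) (d261 ρ₀)
    hB₀ hδ₀ hκ hρ hα₁.le (by norm_num) (by norm_num) hΛ1 h261j hSTj hsmall hE h85.1 h85.2).1

end Step

end Literature.MathematicalPhysics.QuantumFieldTheory.Balaban1983to89.B9SectBGStepCodedF

end
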